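import Literature.AlgebraicGeometry.ModuliOfAbelianVarieties.SiegelPeriodLinearAvatar
import Mathlib.Geometry.Manifold.MFDeriv.SpecificFunctions
import HarnessLib

/-!
# The `ℂ`-linear avatar of a period-linear integral matrix ALONG A HOLOMORPHIC LIFT: a holomorphic operator-valued family carrying the tautological
# periods to themselves ([BirkenhakeLange2004] §1.2 Prop. 1.2.1, §8.1; [Shimura1963AnalyticFamilies] §2)

Layer `Literature/AlgebraicGeometry/ModuliOfAbelianVarieties`, namespace `Literature.AlgebraicGeometry.ModuliOfAbelianVarieties`.  THEOREMS ONLY (no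
definition, no named fact, no instance, no notation, no `sorry`).  Sequel of ★ E6-lin `SiegelPeriodLinearAvatar`.  Cell `hodgecm-mathlib` (D-0151), FLOOR 0,
P6 «MOD» (crux hLiu418 = stmt-HodgeConjecture-24832, `--supports`), organ **COV-3∕4 «AVATAR FAMILY»** of the E6 closer of
`Cruxes/HLiu418/Lines/F0_P6a_PELWitnessE.lean` (socket Σ-AN `ReadsCReading`, census `CENSUS-SigmaAN.v1` rows COV-3, COV-4; E6 heir A-p06 (g33)): it produces,
chart by chart, the inputs `(C_i, hC_i, N_i, hN_i)` of ★ E6-an′ `AbelianSchemeOver.exists_isMonHom_of_chartReadings` from the pointwise avatar field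
`AuxChartGS.Mρ_kottwitz` (first conjunct), the holomorphic period function `AuxChartGS.Z a` (`Z_hol`) and a holomorphic local section `σ` of the ball
uniformisation (★ `UnitaryBallUniformisationDatum.exists_mdifferentiableAt_section'`).  HC_CM is proved only modulo the printed citations (2 remaining
named inputs hLiu418 24832, h413 24833) until rung 0 closes; this file is generic and changes no count.

THE MATHEMATICS.  Let `Z : V → M_g(ℂ)` be entrywise holomorphic on an open `cone ⊆ V` and `A ∈ M_{2g}(ℤ)` such that at EVERY `v ∈ cone` the real-linear
map `A_ℝ` of `ℝ^{2g}` is `ℂ`-linear for the complex structure transported by the period map `Π_{Z v} : ℝ^{2g} ⥲ ℂ^g` — i.e. there is SOME `ℂ`-linear `C_v` with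
`C_v ∘ Π_{Z v} = Π_{Z v} ∘ A_ℝ` (the first conjunct of `Mρ_kottwitz`).  `C_v` is unique (★ `eq_of_comp_siegelPeriodMap_eq`) and `v ↦ C_v` is holomorphic on the
cone (★ E6-lin `differentiableOn_clm_of_comp_siegelPeriodMap`).  Along a map `σ : T → V` from a complex manifold, holomorphic on an open `W` with `σ(W) ⊆ cone`,
the family `t ↦ C_{σ t}` is therefore holomorphic on `W` (chain rule) and carries the tautological period family `Φ t = Π_{Z (σ t)}` into itself with the
CONSTANT integral matrix `A`: `C_{σ t} (Φ t n) = Φ t (A n)` for `n ∈ ℤ^{2g}` — exactly the shape `(C, hC, N, hN)` of ★ U6-b ∕ ★ E6-an′.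

* §1 `exists_clm_of_comp_siegelPeriodMap` — a global operator-valued choice `C : V → (ℂ^g →L[ℂ] ℂ^g)` with the avatar property on the cone, holomorphic there.
* §2 **`exists_clm_family_along_lift`** — THE HEAD: along `σ`, `∃ Cfam : T → (ℂ^g →L[ℂ] ℂ^g)`, `MDifferentiableOn` on `W`, avatar property at `Z (σ t)`,
  and the integral period law for any period family `Φ` agreeing with `Π_{Z ∘ σ}` on `W`.

## References
* [BirkenhakeLange2004] C. Birkenhake, H. Lange, *Complex Abelian Varieties*, 2nd ed. (2004), §1.2 Proposition 1.2.1 and (1.2) (analytic and rational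
  representations), §8.1 (families over `𝔥_g`).
* [Shimura1963AnalyticFamilies] G. Shimura, *On analytic families of polarized abelian varieties and automorphic functions*, Ann. Math. 78 (1963), §2.
-/

set_option autoImplicit false

noncomputable section

open Matrix
open scoped Manifold

namespace Literature.AlgebraicGeometry.ModuliOfAbelianVarieties

variable {g : ℕ} {δ : Fin g → ℕ} {V : Type*} [NormedAddCommGroup V] [NormedSpace ℂ V]

/-! ## §1 A holomorphic operator-valued choice of the avatar on the cone -/

/-- **The avatar as a holomorphic operator-valued function on the cone.**  If at every `v ∈ cone` SOME `ℂ`-linear `C_v` satisfies `C_v ∘ Π_{Z v} = Π_{Z v} ∘ A_ℝ`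
(`Z` entrywise holomorphic on the open `cone`), then there is ONE function `C : V → (ℂ^g →L[ℂ] ℂ^g)` with that property at every point of the cone, holomorphic
on the cone (choice + ★ E6-lin `differentiableOn_clm_of_comp_siegelPeriodMap`). [cite: BirkenhakeLange2004, §1.2 Proposition 1.2.1 and (1.2)] [cite: Shimura1963AnalyticFamilies, §2] -/
theorem exists_clm_of_comp_siegelPeriodMap (hδ : ∀ i, 0 < δ i) {cone : Set V} {Z : V → Matrix (Fin g) (Fin g) ℂ}
    (hZ : ∀ k j, DifferentiableOn ℂ (fun v => Z v k j) cone) (A : Matrix (Fin g ⊕ Fin g) (Fin g ⊕ Fin g) ℝ)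
    (hK : ∀ v ∈ cone, ∃ Cv : (Fin g → ℂ) →ₗ[ℂ] (Fin g → ℂ), ∀ u : Fin g ⊕ Fin g → ℝ, Cv (siegelPeriodMap δ (Z v) u) = siegelPeriodMap δ (Z v) (A *ᵥ u)) :
    ∃ C : V → ((Fin g → ℂ) →L[ℂ] (Fin g → ℂ)), DifferentiableOn ℂ C cone ∧
      ∀ v ∈ cone, ∀ u : Fin g ⊕ Fin g → ℝ, C v (siegelPeriodMap δ (Z v) u) = siegelPeriodMap δ (Z v) (A *ᵥ u) := by
  classical
  choose Cv hCv using hK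
  let C : V → ((Fin g → ℂ) →L[ℂ] (Fin g → ℂ)) := fun v =>
    if hv : v ∈ cone then LinearMap.toContinuousLinearMap (Cv v hv) else 0
  have hC : ∀ v ∈ cone, ∀ u : Fin g ⊕ Fin g → ℝ, C v (siegelPeriodMap δ (Z v) u) = siegelPeriodMap δ (Z v) (A *ᵥ u) := by
    intro v hv u
    simp only [C, dif_pos hv, LinearMap.coe_toContinuousLinearMap']
    exact hCv v hv u
  exact ⟨C, differentiableOn_clm_of_comp_siegelPeriodMap hδ hZ A C hC, hC⟩

/-! ## §2 The head: the avatar family along a holomorphic lift -/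

/-- **THE AVATAR FAMILY ALONG A HOLOMORPHIC LIFT** (inputs `(C, hC, N, hN)` of ★ E6-an′ ∕ ★ U6-b, chart by chart).  `Z` entrywise holomorphic on the open
`cone`, `A ∈ M_{2g}(ℤ)` with a `ℂ`-linear avatar at every point of the cone (shape of `AuxChartGS.Mρ_kottwitz`, first conjunct), `T` a complex manifold,
`σ : T → V` holomorphic at every point of `W` with `σ(W) ⊆ cone` (a local section of the ball uniformisation), and `Φ t = Π_{Z (σ t)}` on `W` (the tautological
period family of ★ P-3, first clause).  THEN there is `Cfam : T → (ℂ^g →L[ℂ] ℂ^g)`, holomorphic on `W` (`MDifferentiableOn`), with the avatar property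
`Cfam t ∘ Π_{Z (σ t)} = Π_{Z (σ t)} ∘ A_ℝ` on `W` and the INTEGRAL PERIOD LAW `Cfam t (Φ t n) = Φ t (A n)` for every `n ∈ ℤ^{2g}` (`N t := A *ᵥ ·`, constant).
[cite: BirkenhakeLange2004, §1.2 Proposition 1.2.1 and (1.2); §8.1] [cite: Shimura1963AnalyticFamilies, §2] -/
theorem exists_clm_family_along_lift (hδ : ∀ i, 0 < δ i) {cone : Set V} (hcone : IsOpen cone) {Z : V → Matrix (Fin g) (Fin g) ℂ}
    (hZ : ∀ k j, DifferentiableOn ℂ (fun v => Z v k j) cone) (A : Matrix (Fin g ⊕ Fin g) (Fin g ⊕ Fin g) ℤ)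
    (hK : ∀ v ∈ cone, ∃ Cv : (Fin g → ℂ) →ₗ[ℂ] (Fin g → ℂ),
      ∀ u : Fin g ⊕ Fin g → ℝ, Cv (siegelPeriodMap δ (Z v) u) = siegelPeriodMap δ (Z v) ((A.map (Int.cast : ℤ → ℝ)) *ᵥ u))
    {EB : Type*} [NormedAddCommGroup EB] [NormedSpace ℂ EB] {T : Type*} [TopologicalSpace T] [ChartedSpace EB T]
    {W : Set T} (σ : T → V) (hσW : ∀ t ∈ W, σ t ∈ cone) (hσ : ∀ t ∈ W, MDifferentiableAt 𝓘(ℂ, EB) 𝓘(ℂ, V) σ t)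
    (Φ : T → ((Fin g ⊕ Fin g → ℝ) ≃L[ℝ] (Fin g → ℂ))) (hΦ : ∀ t ∈ W, ∀ u : Fin g ⊕ Fin g → ℝ, Φ t u = siegelPeriodMap δ (Z (σ t)) u) :
    ∃ Cfam : T → ((Fin g → ℂ) →L[ℂ] (Fin g → ℂ)),
      MDifferentiableOn 𝓘(ℂ, EB) 𝓘(ℂ, (Fin g → ℂ) →L[ℂ] (Fin g → ℂ)) Cfam W ∧
      (∀ t ∈ W, ∀ u : Fin g ⊕ Fin g → ℝ, Cfam t (siegelPeriodMap δ (Z (σ t)) u) = siegelPeriodMap δ (Z (σ t)) ((A.map (Int.cast : ℤ → ℝ)) *ᵥ u)) ∧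
      ∀ t ∈ W, ∀ n : Fin g ⊕ Fin g → ℤ, Cfam t (Φ t (fun k => (n k : ℝ))) = Φ t (fun k => ((A *ᵥ n) k : ℝ)) := by
  obtain ⟨C, hCd, hC⟩ := exists_clm_of_comp_siegelPeriodMap hδ hZ (A.map (Int.cast : ℤ → ℝ)) hK
  refine ⟨fun t => C (σ t), ?_, fun t ht u => hC (σ t) (hσW t ht) u, ?_⟩
  · -- chain rule: `C` is holomorphic on the open cone, `σ` at the points of `W`
    intro t ht
    have h1 : MDifferentiableAt 𝓘(ℂ, V) 𝓘(ℂ, (Fin g → ℂ) →L[ℂ] (Fin g → ℂ)) C (σ t) :=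
      ((hCd (σ t) (hσW t ht)).differentiableAt (hcone.mem_nhds (hσW t ht))).mdifferentiableAt
    exact (h1.comp t (hσ t ht)).mdifferentiableWithinAt
  · -- the integral period law: `A_ℝ n = A n` for integral `n`
    intro t ht n
    have hAn : (A.map (Int.cast : ℤ → ℝ)) *ᵥ (fun k => (n k : ℝ)) = fun k => ((A *ᵥ n) k : ℝ) := by
      funext k
      simp only [Matrix.mulVec, dotProduct, Matrix.map_apply, Int.cast_sum, Int.cast_mul]
    rw [hΦ t ht, hΦ t ht, hC (σ t) (hσW t ht), hAn]

end Literature.AlgebraicGeometry.ModuliOfAbelianVarieties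

end
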